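import Summits.ResolutionOfSingularities.ResolutionOfSingularities.Theorems.TameTwoStoreyLU6
import HarnessLib

/-!
# TameTwoStoreyLU7 — THE LAW `relLU_of_tameOverInertLUAbove` (steps (1)–(4): `G`-invariance of `v′`, the inertia subgroup and its enumeration, the fixed field `K_T`, the separator; then `relLU_of_twoStoreyFrame`)

One of the landing files of the g29 node «TameTwoStorey» of the ROOT/RESIDUAL decomposition cell `decomp-res` (lens 1,
window (W-α) WHOLE; files `TameTwoStoreyLU`, `…LU1B`, `…LU2` (landed), `…LU3`–`…LU8`); see the module docstring of
`Summits.ResolutionOfSingularities.ResolutionOfSingularities.Theorems.TameTwoStoreyLU` for the thesis, the cell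
`TameOverInertLUAbove k O` (in `…LU2`), the law `relLU_of_tameOverInertLUAbove : TameOverInertLUAbove k O →
RelLocalUniformization k K O` (in `…LU7`), the paper instances and the sources.  This file: the law only (NAME and TYPE as pinned: `(h : TameOverInertLUAbove k O) : RelLocalUniformization k K O`).
Imports: `…TameTwoStoreyLU6`.  Problem side, sorry-free, hypothesis-free; every heavy theorem carries
`set_option maxHeartbeats … in` BEFORE its docstring — keep it.
-/

noncomputable section

open IsLocalRing Polynomial IntermediateField Literature.AlgebraicGeometry.Resolution
open Summit.ResolutionOfSingularities.ResolutionOfSingularities.Theorems.TameQuotientLU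
open Summit.ResolutionOfSingularities.ResolutionOfSingularities.Theorems.TameAbelianQuotientLU
open Summit.ResolutionOfSingularities.ResolutionOfSingularities.Theorems.InertiaIsotypicStability
open Summit.ResolutionOfSingularities.ResolutionOfSingularities.Theorems.TameInertialLU
open Summit.ResolutionOfSingularities.ResolutionOfSingularities.Theorems.TameAbelianMonomialChart

namespace Summit.ResolutionOfSingularities.ResolutionOfSingularities.Theorems.TameTwoStoreyLU

universe u

section Law

variable (k : Type) [Field k] {K : Type} [Field K] [Algebra k K]

variable {k}

set_option maxHeartbeats 1600000 in
/-- **THE KERNEL LAW OF THE TWO-STOREY TAME CELL** — `TameOverInertLUAbove k O → RelLocalUniformization k K O`,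
HYPOTHESIS-FREE, for EVERY inert storey `H = G/T` («Kummer–Lagrange twist»; PRE-RULINGs decomp-res-crit-1 STATUS
:1914 (C2)(ii) / :1951).  Proof — steps (1)–(4) below build the INERTIA FRAME, then `relLU_of_twoStoreyFrame`
(steps (5)–(11): `exists_semiInvariant_regularParameters` = STEP C, `exists_stable_fixed_chart` = STEP D,
`exists_descended_model_of_inert` = STEP E, `relLU_transport` = STEP F); ONE application of the model clause;
tree tools of g26/g28 by name:
(1)–(2) frame: `O = O′ ∩ K`, non-zero constants of `k` are units of `O′`, the `e`-th roots of unity of `K′` are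
units at residual distance `1` (`TameInertialLU.valuation_sub_one_eq_one`), every `g ∈ G` preserves `v′`
(`InertiaIsotypicStability.valuation_apply_eq`); (3) the inertia subgroup `T` (`inertiaSubgroup`: normal, and
abelian of exponent `e` by (A2)), enumerated `τ : ℕ → K′ ≃+* K′`, its fixed field `K_T` (a `G`-stable subfield
containing `ι(K)` and `ζ`), and a `T`-fixed SEPARATOR `x_s ∈ O′` of the inert storey (`exists_inertia_separator`:
`v′(x_s − g x_s) = 1` for `g ∉ T`, using `|T| ∈ O′×` by Cauchy), so that `Stab_G(x_s) ⊆ T`; (4)–(5) for every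
character `c : T → μ_e(K′)` occurring on `O′` an eigenvector `f_c ∈ O′ ∖ 0`; ISOTYPIC STABILITY
(`InertiaIsotypicStability.isotypic_stability`, from (A1)–(A2) alone — no cyclotomic-compatibility clause):
`g f_c` is again a `c`-eigenvector, so the TWISTING UNITS `g f_c / g′ f_c` are `T`-fixed of value `1`; (6) ONE
call of the model clause with `z := G · ({ζ, x_s} ∪ {f_c}_c ∪ {g f_c / g′ f_c})` ⇒ a `G`-stable model
`M = ι(R)[t₀] ⊇ z` in `O′` with `B := locAtCentre M O′` regular of dimension `d`; (7) jointly `T`-EIGEN regular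
parameters `x_j` of `B` with characters `c_j`
(`Literature…TameAbelianEigenparameters.exists_joint_eigen_regularParameters_of_commuting`); (8) STEP C —
LAGRANGE DESCENT ALONG `H` IN THE `K_T`-FRAME: `n_j := x_j / f_{c_j} ∈ K_T` lies in the `H`-stable
`locAtCentre (M ∩ K_T) (O′ ∩ K_T)`-module `N_j = {n ∈ K_T | f_{c_j} n ∈ 𝔪_B}` (`H`-stability BY THE TWIST:
`f · g n = g (f n) · (f / g f)`), so `InvariantDescentLU.exists_sum_fixed_of_stable` (separator `x_s`; the
`K_T`-frame is read through `StableRestrict`) writes `n_j = ∑ a_i m_i` with `a_i ∈ B` and `m_i ∈ N_j` `G`-FIXED;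
hence `𝔪_B` is generated by SEMI-INVARIANTS `f_{c_j} · m` (`m` `G`-fixed) and Nakayama
(`exists_fin_of_span_eq_maximalIdeal`) extracts a regular system of parameters `u_j = f_j m_j` with
`g u_j = ε_{g,j} u_j`, `ε_{g,j} = g f_j / f_j ∈ M ∩ K_T`, `τ_i u_j = ζ^{s i j} u_j`; (9) STEP D — the jointly
`T`-fixed MONOMIAL CHART `y_l = ∏ u_j ^ n_{lj}` over `A = B ∩ K′^T`
(`TameAbelianMonomialChart.exists_fixed_monomialChart_of_commuting_isRegularLocalRing`; `hAuc`, `halgA` as in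
g26 `TameAbelianQuotientLU2`) and the model `T₁ = ι(R)[G₁, y] ⊆ O′ ∩ K_T`, regular at the centre of `O′`
(`exists_finset_closure_eq_inf_jointFixedSubring`, `locAtCentre_inf_jointFixedSubring_eq`,
`locAtCentre_closure_locAtCentre_union_eq`), and `G`-STABLE because `g y_l = (∏_j ε_{g,j}^{n_{lj}}) · y_l` with
`ε^{±1} ∈ M ∩ K′^T ⊆ T₁` (`apply_prod_zpow_eq`, `zpow_mem_of_inv_mem`); (10) STEP E — DESCENT ALONG `H`: ENGINE-2
`InvariantDescentLU.isRegularLocalRing_locAtCentre_inf_fixed_of_fg` + `exists_finset_inf_fixed_eq_closure`, read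
inside `K_T` (`StableRestrict.isRegularLocalRing_locAtCentre_comap_iff`, `map_locAtCentre_comap`), with
`K_T = ι(K)(x_s)` by the Galois correspondence (`exists_aeval_eq_of_fixed`) and `Frac T₁ = K_T`: the ring
`T₁ ∩ ι(K) = ι(R)[t]` is finitely generated with `t ⊆ ι(K)` and `locAtCentre (T₁ ∩ ι(K)) O′` is regular;
(11) STEP F — transport to `K` (`relLU_transport`, g26 (6)–(7)).
NO SECTION `H → G` IS USED (probe (p3), `#print axioms` standard): a complemented proof (`G = T ⋊ H̃`,
Schur–Zassenhaus, `gcd(|H|,|T|) = 1`) would use `H̃`-fixed eigenparameters at STEP C; here the twisting units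
`ε_{g,χ} = g f_χ / f_χ ∈ (M ∩ K_T)×`, absorbed into `z`, replace them — the paper control is the non-split top
`G = Q₈ ⊋ T = C₄` (NODE-g29.md §4), where no complement exists.  No typed Literature fact, no port.
(Sources: CossartPiltant2008, Lemma 9.4; CossartPiltant2019, Prop. 4.10; Kuhlmann2000, Sections 13-15;
ZariskiSamuel1975 VI Section 12; Lagrange resolvents / isotypic decomposition for `μ_e ⊆ K′` [folklore].) -/
theorem relLU_of_tameOverInertLUAbove {O : ValuationSubring K} (h : TameOverInertLUAbove k O) :
    RelLocalUniformization k K O := by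
  classical
  intro R hRfg hRfrac hRO
  obtain ⟨K', hfin, hgal, e, he, hek, ζ, hζ, O', hO'O, hGO', habel, hexp, halgO, hLU⟩ := h
  haveI := hfin
  haveI := hgal
  have he0 : e ≠ 0 := he.ne'
  -- (1) `O = O′ ∩ K`; `G` fixes `K` and `k`; non-zero constants of `k` are units of `O′`
  have hmemO : ∀ x : K, x ∈ O ↔ algebraMap K K' x ∈ O' := fun x => by
    rw [← hO'O]
    rfl
  have hgf : ∀ (g : K' ≃ₐ[K] K') (x : K), g (algebraMap K K' x) = algebraMap K K' x :=
    fun g x => g.commutes x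
  have hfk : ∀ c : k, algebraMap K K' (algebraMap k K c) = algebraMap k K' c := fun c =>
    (IsScalarTower.algebraMap_apply k K K' c).symm
  have hkO' : ∀ c : k, algebraMap k K' c ∈ O' := fun c => by
    rw [← hfk]
    exact (hmemO _).mp (hRO (R.algebraMap_mem c))
  have hkunit : ∀ c : k, c ≠ 0 → O'.valuation (algebraMap k K' c) = 1 := by
    intro c hc
    refine le_antisymm ((O'.valuation_le_one_iff _).mpr (hkO' c)) ?_
    have hne : algebraMap k K' c ≠ 0 := (_root_.map_ne_zero _).mpr hc
    have h2 : O'.valuation (algebraMap k K' c⁻¹) ≤ 1 := (O'.valuation_le_one_iff _).mpr (hkO' _)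
    rw [map_inv₀, map_inv₀, inv_le_one₀ ((Valuation.pos_iff _).mpr hne)] at h2
    exact h2
  have hve : O'.valuation (e : K') = 1 := by
    have h1 : (e : K') = algebraMap k K' (e : k) := by rw [map_natCast]
    rw [h1]
    exact hkunit _ hek
  -- roots of unity of `K′` are units of `O′` at residual distance `1` from each other
  have hμ1 : ∀ w : K', w ^ e = 1 → O'.valuation w = 1 := fun w hw =>
    (pow_eq_one_iff_left he0).mp (by rw [← map_pow, hw, map_one])
  have hμO : ({w : K' | w ^ e = 1} : Set K') ⊆ O' := fun w hw =>
    (O'.valuation_le_one_iff _).mp (hμ1 w hw).le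
  have hμ : ∀ a ∈ ({w : K' | w ^ e = 1} : Set K'), ∀ b ∈ ({w : K' | w ^ e = 1} : Set K'), a ≠ b →
      O'.valuation (a - b) = 1 := by
    intro a ha b hb hab
    rw [Set.mem_setOf_eq] at ha hb
    have hb0 : b ≠ 0 := by
      rintro rfl
      rw [zero_pow he0] at hb
      exact zero_ne_one hb
    have hη : (a / b) ^ e = 1 := by rw [div_pow, ha, hb, div_one]
    have hη1 : a / b ≠ 1 := fun h1 => hab (by rwa [div_eq_one_iff_eq hb0] at h1)
    have h1 : a - b = b * (a / b - 1) := by rw [mul_sub, mul_one, mul_div_cancel₀ _ hb0]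
    rw [h1, map_mul, hμ1 b hb, one_mul]
    exact valuation_sub_one_eq_one O' hve (hμ1 _ hη).le hη hη1
  have hζe : ζ ^ e = 1 := hζ.pow_eq_one
  have hζO' : ζ ∈ O' := hμO hζe
  have hζ0 : ζ ≠ 0 := hζ.ne_zero he0
  have hvη : ∀ j : ℕ, 0 < j → j < e → O'.valuation (ζ ^ j - 1) = 1 := by
    intro j hj hje
    have h1 := hμ (ζ ^ j) (by rw [Set.mem_setOf_eq, ← pow_mul, mul_comm, pow_mul, hζe, one_pow]) 1
      (by rw [Set.mem_setOf_eq, one_pow]) (hζ.pow_ne_one_of_pos_of_lt hj.ne' hje)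
    exact h1
  -- (2) the Galois group `G`, its action by ring automorphisms, values are `G`-invariant
  let φ : (K' ≃ₐ[K] K') →* (K' ≃+* K') :=
    { toFun := fun g => (g : K' ≃+* K')
      map_one' := RingEquiv.ext fun _ => rfl
      map_mul' := fun _ _ => RingEquiv.ext fun _ => rfl }
  have hφ : ∀ (g : K' ≃ₐ[K] K') (y : K'), φ g y = g y := fun _ _ => rfl
  have hGOφ : ∀ (g : K' ≃ₐ[K] K') (y : K'), y ∈ O' ↔ φ g y ∈ O' := fun g y => hGO' g y
  have hgv : ∀ (g : K' ≃ₐ[K] K') (y : K'), O'.valuation (g y) = O'.valuation y := fun g y =>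
    valuation_apply_eq O' (g := (g : K' ≃+* K')) (hGO' g) (orderOf_pos g)
      (toRingEquiv_pow_eq_one (pow_orderOf_eq_one g)) y
  -- (3) the inertia subgroup `T` (normal), enumerated as `τ 0, …, τ (r-1)`
  set T := inertiaSubgroup O' φ hGOφ with hTdef
  have hmemT : ∀ g : K' ≃ₐ[K] K', g ∈ T ↔ ∀ y ∈ O', O'.valuation (g y - y) < 1 := fun g => Iff.rfl
  have hTexp : ∀ g ∈ T, g ^ e = 1 := fun g hg => hexp g ((hmemT g).mp hg)
  have hTcomm : ∀ g ∈ T, ∀ g' ∈ T, g * g' = g' * g := fun g hg g' hg' =>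
    habel g g' ((hmemT g).mp hg) ((hmemT g').mp hg')
  have hTconj : ∀ (g : K' ≃ₐ[K] K') {t : K' ≃ₐ[K] K'}, t ∈ T → g⁻¹ * t * g ∈ T := by
    intro g t ht
    have h1 := conj_mem_inertiaSubgroup O' φ hGOφ g⁻¹ ht
    rwa [inv_inv] at h1
  obtain ⟨r, ⟨en⟩⟩ := Finite.exists_equiv_fin T
  let τ : ℕ → K' ≃+* K' := fun i =>
    if hi : i < r then (((en.symm ⟨i, hi⟩ : T) : K' ≃ₐ[K] K') : K' ≃+* K') else RingEquiv.refl K'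
  have hτi : ∀ i (hi : i < r), τ i = (((en.symm ⟨i, hi⟩ : T) : K' ≃ₐ[K] K') : K' ≃+* K') :=
    fun i hi => dif_pos hi
  have hτapp : ∀ i < r, ∃ g : K' ≃ₐ[K] K', g ∈ T ∧ ∀ z, τ i z = g z := fun i hi =>
    ⟨_, (en.symm ⟨i, hi⟩).2, fun z => by rw [hτi i hi]; rfl⟩
  have hτg : ∀ g : K' ≃ₐ[K] K', g ∈ T → ∃ i, i < r ∧ ∀ z, τ i z = g z := fun g hg =>
    ⟨(en ⟨g, hg⟩).val, (en ⟨g, hg⟩).isLt, fun z => by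
      rw [hτi _ (en ⟨g, hg⟩).isLt, Fin.eta, Equiv.symm_apply_apply]; rfl⟩
  have hτres : ∀ i < r, ∀ y ∈ O', O'.valuation (τ i y - y) < 1 := by
    intro i hi y hy
    obtain ⟨g, hgT, hg⟩ := hτapp i hi
    rw [hg y]
    exact (hmemT g).mp hgT y hy
  have hτe : ∀ i < r, τ i ^ e = 1 := by
    intro i hi
    rw [hτi i hi]
    exact toRingEquiv_pow_eq_one (hTexp _ (en.symm ⟨i, hi⟩).2)
  have hcomm : ∀ i < r, ∀ i' < r, ∀ z : K', τ i (τ i' z) = τ i' (τ i z) := by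
    intro i hi i' hi' z
    obtain ⟨g, hgT, hg⟩ := hτapp i hi
    obtain ⟨g', hg'T, hg'⟩ := hτapp i' hi'
    rw [hg', hg, hg, hg', ← AlgEquiv.mul_apply, hTcomm g hgT g' hg'T, AlgEquiv.mul_apply]
  -- `T` fixes the roots of unity (tameness: `v(tζ − ζ) < 1` and `v(ζ' − ζ) = 1` for `ζ' ≠ ζ`)
  have hTμ : ∀ g ∈ T, ∀ w : K', w ^ e = 1 → g w = w := by
    intro g hg w hw
    by_contra hne
    have hgw : (g w) ^ e = 1 := by rw [← map_pow, hw, map_one]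
    have h1 : O'.valuation (g w - w) = 1 := hμ _ hgw _ hw hne
    exact absurd h1 (ne_of_lt ((hmemT g).mp hg w (hμO hw)))
  have hτζ : ∀ i < r, τ i ζ = ζ := by
    intro i hi
    obtain ⟨g, hgT, hg⟩ := hτapp i hi
    rw [hg]
    exact hTμ g hgT ζ hζe
  -- normality: `τ i ∘ g = g ∘ τ i'`
  have hnormal : ∀ (g : K' ≃ₐ[K] K') (i : ℕ), i < r → ∃ i', i' < r ∧ ∀ y, τ i (g y) = g (τ i' y) := by
    intro g i hi
    obtain ⟨t, ht, hτt⟩ := hτapp i hi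
    obtain ⟨i', hi', hτi'⟩ := hτg _ (hTconj g ht)
    refine ⟨i', hi', fun y => ?_⟩
    rw [hτt, hτi', AlgEquiv.mul_apply, AlgEquiv.mul_apply, ← AlgEquiv.mul_apply g g⁻¹, mul_inv_cancel,
      AlgEquiv.one_apply]
  -- the fixed field `K_T` of `T` (a `G`-stable subfield)
  let KT : Subfield K' :=
    { toSubring := jointFixedSubring τ r
      inv_mem' := fun z hz => by
        have hz' : z ∈ jointFixedSubring τ r := hz
        rw [mem_jointFixedSubring] at hz'
        show z⁻¹ ∈ jointFixedSubring τ r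
        rw [mem_jointFixedSubring]
        intro i hi
        rw [map_inv₀, hz' i hi] }
  have hKT : ∀ z : K', z ∈ KT ↔ ∀ i < r, τ i z = z := fun z => by
    show z ∈ jointFixedSubring τ r ↔ _
    exact mem_jointFixedSubring τ r z
  have hKT' : ∀ z : K', z ∈ KT ↔ ∀ g ∈ T, g z = z := by
    intro z
    rw [hKT]
    constructor
    · intro hz g hg
      obtain ⟨i, hi, hgi⟩ := hτg g hg
      rw [← hgi]
      exact hz i hi
    · intro hz i hi
      obtain ⟨g, hgT, hg⟩ := hτapp i hi
      rw [hg]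
      exact hz g hgT
  have hGKT1 : ∀ (g : K' ≃ₐ[K] K') (z : K'), z ∈ KT → g z ∈ KT := by
    intro g z hz
    rw [hKT] at hz ⊢
    intro i hi
    obtain ⟨i', hi', hc⟩ := hnormal g i hi
    rw [hc, hz i' hi']
  have hGKT : ∀ (g : K' ≃ₐ[K] K') (z : K'), z ∈ KT ↔ g z ∈ KT := fun g z =>
    ⟨hGKT1 g z, fun hz => by
      have h1 := hGKT1 g⁻¹ _ hz
      rwa [← AlgEquiv.mul_apply, inv_mul_cancel, AlgEquiv.one_apply] at h1⟩
  have hKKT : ∀ x : K, algebraMap K K' x ∈ KT := fun x =>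
    (hKT' _).mpr fun g _ => hgf g x
  -- (4) the residual separator `x ∈ O′ ∩ K_T` of `G/T`
  obtain ⟨xs, hxsO, hxsT, hxsep⟩ := exists_inertia_separator O' φ hGOφ hve hTexp
  have hfixT : ∀ g : K' ≃ₐ[K] K', g xs = xs → g ∈ T := by
    intro g hgx
    by_contra hg
    have h1 := hxsep g hg
    rw [hφ, hgx, sub_self, map_zero] at h1
    exact zero_ne_one h1
  have hxsKT : xs ∈ KT := (hKT' xs).mpr hxsT
  -- (5)–(11): eigenvectors, isotypic stability, ONE model-clause call, STEPS C–F (`relLU_of_twoStoreyFrame`)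
  exact relLU_of_twoStoreyFrame hO'O hGO' hgv he hve hμO hμ hζe hζ0 hζO' hvη T τ r
    (fun i hi => by obtain ⟨g, -, hg⟩ := hτapp i hi; exact ⟨g, hg⟩) hτe hcomm hτres hτζ hnormal KT hKT hKT'
    hGKT hKKT hxsO hxsKT hfixT (fun g hg => hxsep g hg) halgO hRfg hRfrac (hLU R hRfg hRfrac hRO)

end Law

end Summit.ResolutionOfSingularities.ResolutionOfSingularities.Theorems.TameTwoStoreyLU

end
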